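import Summits.Ventures.GridStability.Bench.WSCC9Deg4ASosgramDinstData15
import Summits.Ventures.GridStability.Bench.WSCC9Deg4ASosgramDinstData18
import Summits.Ventures.GridStability.Bench.WSCC9Deg4ASosgramDinstData19
import Literature.Computation.Certificates.GramSOSList
import HarnessLib
-- import re-plumb (gridfusion-sos-3 g3, 2026-08-27): this file = emitter v0.9 output (kit j267541) with ONLY its `import` block
-- rewritten to the shards it actually references (the emitted linear chain Data k → Data k−1 costs one hub olean-build wait per file).
-- PORT cert/sos-5/emit_lean.py@a0fbeb927efb3b7b / source WSCC9-deg4-A-sosgram-Dinst.json sha256: 9d83c75afa575de83560d25f77d549e4d3648c3bbe936f375082822466631ae6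
-- estimated kernel time of this file's `decide`s: 199 s (emitter calibration 2026-08-26; RULING 8 budget 200 s per file)

/-!
# Ventures/GridStability — Bench/WSCC9Deg4ASosgramDinstChk2.lean: L8 ROW-RANGE CHUNK EQUALITIES 2 of 3 of certificate file `WSCC9-deg4-A-sosgram-Dinst` (system WSCC9, V degree 4, toolchain A)

Kernel zero tests `isZero (normMS P_t − GramL.polyRange lo n)`
(Literature/Computation/Certificates/GramSOSList.lean, lane L8 of RULING 19 (5b)): the partial sums
shipped in the Data shards ARE the row ranges of the free Gram polynomial of certificate
`WSCC9-deg4-A-sosgram-Dinst`; theorems `deg4_A_sosgram_Dinst_dom_incl_0_chunk1`,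
`deg4_A_sosgram_Dinst_dom_incl_0_chunk2`, `deg4_A_sosgram_Dinst_dom_incl_1_chunk0`,
`deg4_A_sosgram_Dinst_dom_incl_1_chunk1`. Assembled into `GramL.ChunkEqs` in the proof file.
Estimated 199 s here. «algebraic inequalities certified; ROA inclusion pending Lyapunov/ lemma».
-/

namespace Summit.Ventures.GridStability.Bench.WSCC9

open Literature.Computation.Certificates Literature.Computation.Certificates.SOS
open Literature.Computation.Certificates.SOS.Poly

/-! ### L8 row-range chunk equalities (`GramL.polyRange`, `decide +kernel`) -/

set_option maxHeartbeats 0 in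
/-- L8 CHUNK EQUALITY 2/3 of `deg4_A_sosgram_Dinst_dom_incl_0`: the shipped partial sum `deg4_A_sosgram_Dinst_dom_incl_0_P1` IS the free block's Gram polynomial on rows 40–79 (`GramL.polyRange`; one `decide`). [folklore] -/
theorem deg4_A_sosgram_Dinst_dom_incl_0_chunk1 :
    isZero (Poly.add (Poly.normMS deg4_A_sosgram_Dinst_dom_incl_0_P1) (Poly.neg (deg4_A_sosgram_Dinst_dom_incl_0_freeL.polyRange 40 40))) = true := by
  decide +kernel

set_option maxHeartbeats 0 in
/-- L8 CHUNK EQUALITY 3/3 of `deg4_A_sosgram_Dinst_dom_incl_0`: the shipped partial sum `deg4_A_sosgram_Dinst_dom_incl_0_P2` IS the free block's Gram polynomial on rows 80–103 (`GramL.polyRange`; one `decide`). [folklore] -/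
theorem deg4_A_sosgram_Dinst_dom_incl_0_chunk2 :
    isZero (Poly.add (Poly.normMS deg4_A_sosgram_Dinst_dom_incl_0_P2) (Poly.neg (deg4_A_sosgram_Dinst_dom_incl_0_freeL.polyRange 80 24))) = true := by
  decide +kernel

set_option maxHeartbeats 0 in
/-- L8 CHUNK EQUALITY 1/3 of `deg4_A_sosgram_Dinst_dom_incl_1`: the shipped partial sum `deg4_A_sosgram_Dinst_dom_incl_1_P0` IS the free block's Gram polynomial on rows 0–39 (`GramL.polyRange`; one `decide`). [folklore] -/
theorem deg4_A_sosgram_Dinst_dom_incl_1_chunk0 :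
    isZero (Poly.add (Poly.normMS deg4_A_sosgram_Dinst_dom_incl_1_P0) (Poly.neg (deg4_A_sosgram_Dinst_dom_incl_1_freeL.polyRange 0 40))) = true := by
  decide +kernel

set_option maxHeartbeats 0 in
/-- L8 CHUNK EQUALITY 2/3 of `deg4_A_sosgram_Dinst_dom_incl_1`: the shipped partial sum `deg4_A_sosgram_Dinst_dom_incl_1_P1` IS the free block's Gram polynomial on rows 40–79 (`GramL.polyRange`; one `decide`). [folklore] -/
theorem deg4_A_sosgram_Dinst_dom_incl_1_chunk1 :
    isZero (Poly.add (Poly.normMS deg4_A_sosgram_Dinst_dom_incl_1_P1) (Poly.neg (deg4_A_sosgram_Dinst_dom_incl_1_freeL.polyRange 40 40))) = true := by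
  decide +kernel

end Summit.Ventures.GridStability.Bench.WSCC9
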